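import Literature.MathematicalPhysics.QuantumFieldTheory.LatticeGaugeDobrushin
import Literature.MathematicalPhysics.QuantumLattice.BalabanRGHaarIterates
import Literature.Probability.LatticeModels.DobrushinTiltSharp
import HarnessLib

/-!
# A strong-coupling ONE-STATE CORNER for EVERY compact gauge group and EVERY representation:
# DLR uniqueness and exponential clustering of lattice Yang–Mills at `|β| < 1/(12(d-1)² C_ρ)`

Cell `pub-ymgap`, seat ds-1 (gen 14). HONEST FRAMING: strong-coupling LATTICE statements for the Wilson
action `S = Σ_p (N − Re tr ρ(U_p))` of an ARBITRARY compact metrisable gauge group `G` and an arbitrary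
continuous finite-dimensional representation `ρ` on `ℤ^d`; a Dobrushin (total-variation) uniqueness corner
`|β| < 1/(12(d−1)² C_ρ)`, `C_ρ ≥ sup_g |Re tr ρ(g)|` — for `SU(2)`, `d = 4` this is `|β| < 1/216` in tree
units (`β_W < 1/108`), FORTY times smaller than the tree's `SU(2)` vertex-star window `9/50`; its point is
not the number but the generality (every `G`, every `ρ`, every `d`, both signs of `β`). Nothing about
weak coupling, the continuum, or the Clay problem. Kernel theorems only, 0 compute.

The tree's DLR-uniqueness theorems for lattice gauge theory are all for `SU(N)` in the fundamental
representation (one-link Kantorovich contraction in the matrix-entry metric: `StarSUN.hasUniqueGibbsMeasure_abs`,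
`DSWindowZd.su2_hasUniqueGibbsMeasure_le_9_25`, …) or at `β = 0`
(`hasUniqueGibbsMeasure_ymSpecification_fundamentalRep_zero`). Here the SAME abstract machinery
(Föllmer's Dobrushin theorem in the Vasserstein form, `subsingleton_gibbsMeasures_of_isKRContraction`, with the
DISCRETE weight `r ≡ 1`, i.e. total variation) is fed with Simon's one-site lemma
(`abs_integral_tilted_sub_integral_tilted_le_linear'`: tilts with `ε`-close exponents are `ε/2`-close in total
variation) and the finite range of the Wilson specification:

1. `isKRContraction_ymSpecification_osc` — for every `G`, `ρ`, `d`, `β`: the one-link conditional laws of the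
   Wilson specification satisfy Dobrushin's condition in the total-variation form with the UNIFORM influence
   coefficient `2(d−1) C_ρ |β|` (changing one plaquette-neighbour link moves the one-link energy by at most
   `2 C_ρ · #{plaquettes through that link} ≤ 4(d−1) C_ρ` in sup norm, `abs_wilsonBoundaryAction_sub_le`,
   `card_plaquettesTouching_singleton_le`; Simon's lemma halves it).
2. ★ `hasUniqueGibbsMeasure_of_abs_plaquetteObs_le` — a link has at most `6(d−1)` plaquette neighbours
   (`card_linkPlaqNbr_le`), so Dobrushin's constant is `≤ 12(d−1)² C_ρ |β|`; when this is `< 1` the DLR state is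
   unique (`|𝒢(β)| = 1`; existence by compactness, `ymGibbsMeasures_nonempty`). The spin space `G` is only
   compact metrisable: the σ-algebra bookkeeping of the abstract theorem is met with `val = id` and Urysohn's
   metric (`TopologicalSpace.metrizableSpaceMetric`). ★ `exists_hasUniqueGibbsMeasure_abs_lt` — hence EVERY
   compact `G`, continuous `ρ`, `d`: `∃ β₀ > 0, ∀ |β| < β₀, |𝒢(β)| = 1` (hypothesis-free).
3. ★ `abs_cov_le_of_abs_plaquetteObs_le` — in the same corner EVERY DLR state clusters exponentially: for bounded
   measurable local observables `f`, `g` depending on the link sets `Λ_f`, `Λ_g`,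
   `|cov(f, g)| ≤ 8 M_f M_g #Λ_f #Λ_g c^{⌊dist(Λ_f, Λ_g)⌋}`, `c = 12(d−1)² C_ρ |β|` (Föllmer's covariance estimate
   `abs_covariance_le_of_isKRContraction` with the profile `⌊dist(·, Λ_g)⌋`).
4. Rows: unitary representations (`C_ρ = N`, `abs_plaquetteObs_le_holds`): `hasUniqueGibbsMeasure_of_unitary`
   at `|β| < 1/(12(d−1)² N)`; compact `U(1)` (`u1Rep`): ★ `u1_hasUniqueGibbsMeasure` at `|β| < 1/(12(d−1)²)`
   (`d = 4`: `1/108`; the tree had no `U(1)` uniqueness statement); `SU(N)` in the fundamental representation at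
   `|β| < 1/(12(d−1)² N)` (`suN_hasUniqueGibbsMeasure`; WEAKER than the tree's `SU(N)` windows — recorded only as
   the every-group formula's value); `SU(2)`, `d = 4`: `|β| < 1/216`.

References (all in the tree): Dobrushin, Theory Probab. Appl. 13 (1968) 197; Simon, CMP 68 (1979) 183; Föllmer,
LNM 1362 (1988) Ch. I (2.7)–(2.20); Georgii, *Gibbs Measures and Phase Transitions* (2011) Thm. 8.7, Prop. 8.8.
-/

noncomputable section

open MeasureTheory Filter Topology ProbabilityTheory Function
open Literature.Probability.LatticeModels
open Literature.Probability.LatticeModels.DobrushinMetric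
open Literature.MathematicalPhysics.QuantumLattice
open Literature.MathematicalPhysics.QuantumFieldTheory hiding ZdEdge

namespace Summit.Ventures.YMGap.StrongCouplingAllGroups

variable {d N : ℕ} {G : Type} [Group G] [TopologicalSpace G] [IsTopologicalGroup G] [CompactSpace G]
  [MeasurableSpace G] [BorelSpace G] [SecondCountableTopology G] (ρ : G →* Matrix (Fin N) (Fin N) ℂ)

/-! ## 1. Dobrushin's condition in the total-variation form for the Wilson specification, every `G` -/

omit [TopologicalSpace G] [IsTopologicalGroup G] [CompactSpace G] [MeasurableSpace G] [BorelSpace G]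
  [SecondCountableTopology G] in
/-- **Oscillation of the one-link Wilson energy under a change of one other link.** If `|Re tr ρ(U_p)| ≤ C`
uniformly, then for configurations `U`, `U'` agreeing off the link `y`,
`|S_{x}(U) − S_{x}(U')| ≤ 2 C · 2(d−1)` (only plaquettes through `y` contribute, at most `2(d−1)` of them,
each by at most `2C`; `abs_wilsonBoundaryAction_sub_le`, `card_plaquettesTouching_singleton_le`). [folklore] -/
theorem abs_wilsonBoundaryAction_singleton_sub_le {C : ℝ} (hC0 : 0 ≤ C)
    (hC : ∀ (z : Site d) (i j : Fin d) (U : LGConfig d G), |plaquetteObs ρ z i j U| ≤ C)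
    (x y : ZdEdge d) {U U' : LGConfig d G} (hU : ∀ e, e ≠ y → U e = U' e) :
    |wilsonBoundaryAction ρ {x} U - wilsonBoundaryAction ρ {x} U'| ≤ 2 * C * (2 * (d - 1 : ℕ) : ℕ) := by
  have h := abs_wilsonBoundaryAction_sub_le ρ hC0 hC {x} {y} (U := U) (U' := U')
    (fun e he => hU e (by simpa using he))
  refine h.trans ?_
  have hcard : ((plaquettesTouching ({y} : Finset (ZdEdge d))).card : ℝ) ≤ ((2 * (d - 1 : ℕ) : ℕ) : ℝ) := by
    exact_mod_cast card_plaquettesTouching_singleton_le y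
  exact mul_le_mul_of_nonneg_left hcard (by positivity)

/-- ★ **Dobrushin's condition, total-variation form, for EVERY compact gauge group.** For every continuous
representation `ρ` with `|Re tr ρ(U_p)| ≤ C` and every coupling `β`, the one-link conditional laws of the Wilson
specification `ymSpecification ρ β` satisfy `IsKRContraction` for the discrete weight `r ≡ 1` over the plaquette
neighbours `linkPlaqNbr`, with the uniform influence coefficient `2(d−1) C |β|`: the two one-link laws are Haar
measure tilted by exponents `−β S_{x}` that differ by at most `4(d−1) C |β|` in sup norm
(`abs_wilsonBoundaryAction_singleton_sub_le`), and Simon's lemma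
(`abs_integral_tilted_sub_integral_tilted_le_linear'`) bounds the difference of the expectations of an
observable of oscillation `≤ L` by half of that times `L`. [cite: Simon1979Dobrushin, Lemma and Remark 2] -/
theorem isKRContraction_ymSpecification_osc (hρ : Continuous ρ) {C : ℝ} (hC0 : 0 ≤ C)
    (hC : ∀ (z : Site d) (i j : Fin d) (U : LGConfig d G), |plaquetteObs ρ z i j U| ≤ C) (β : ℝ) :
    IsKRContraction (ymSpecification (d := d) ρ β) (fun _ _ => (1 : ℝ)) linkPlaqNbr
      (fun _ _ => ((2 * (d - 1 : ℕ) : ℕ) : ℝ) * C * |β|) := by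
  classical
  refine isKRContraction_ymSpecification ρ hρ β (fun _ _ => by positivity) ?_
  intro x y _ ω η hωη φ L hφm hφb hL hφL
  rw [siteLaw_ymSpecification_eq_tilted_haar ρ hρ β x ω, siteLaw_ymSpecification_eq_tilted_haar ρ hρ β x η]
  -- the two exponents
  have hcont : ∀ ζ : LGConfig d G,
      Continuous fun g : G => -β * wilsonBoundaryAction ρ {x} (Function.update ζ x g) := fun ζ =>
    continuous_const.mul ((continuous_wilsonBoundaryAction ρ hρ {x}).comp
      (continuous_const.update x continuous_id))
  have hbdd : ∀ ζ : LGConfig d G,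
      ∃ B, ∀ g : G, |-β * wilsonBoundaryAction ρ {x} (Function.update ζ x g)| ≤ B := fun ζ => by
    refine ⟨|β| * (((N : ℝ) + C) * (plaquettesTouching ({x} : Finset (ZdEdge d))).card), fun g => ?_⟩
    rw [abs_mul, abs_neg]
    exact mul_le_mul_of_nonneg_left (abs_wilsonBoundaryAction_le ρ hC {x} _) (abs_nonneg β)
  -- their sup distance
  have hε : ∀ g : G, |-β * wilsonBoundaryAction ρ {x} (Function.update ω x g) -
      -β * wilsonBoundaryAction ρ {x} (Function.update η x g)| ≤ |β| * (2 * C * (2 * (d - 1 : ℕ) : ℕ)) := by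
    intro g
    have hU : ∀ e, e ≠ y → Function.update ω x g e = Function.update η x g e := by
      intro e he
      by_cases hex : e = x
      · subst hex; simp
      · rw [Function.update_of_ne hex, Function.update_of_ne hex, hωη e he]
    have h := abs_wilsonBoundaryAction_singleton_sub_le ρ hC0 hC x y hU
    rw [← mul_sub, abs_mul, abs_neg]
    exact mul_le_mul_of_nonneg_left h (abs_nonneg β)
  have key := abs_integral_tilted_sub_integral_tilted_le_linear' (haarProbability G)
    (hcont ω).measurable (hcont η).measurable (hbdd ω) (hbdd η) hε hφm hφb (L := L)
    (fun a b => by simpa using hφL a b)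
  refine key.trans (le_of_eq ?_)
  push_cast
  ring

/-! ## 2. DLR uniqueness for every compact gauge group -/

section Unique

variable [T2Space G]

/-- The Dobrushin row sums: every link has at most `6(d−1)` plaquette neighbours (`card_linkPlaqNbr_le`), so the
row sums of the uniform coefficient `2(d−1) C |β|` are at most `12 (d−1)² C |β|`. [folklore] -/
theorem row_sum_le {C β : ℝ} (hC0 : 0 ≤ C) (x : ZdEdge d) :
    ∑ _y ∈ linkPlaqNbr x, ((2 * (d - 1 : ℕ) : ℕ) : ℝ) * C * |β| ≤ 12 * ((d - 1 : ℕ) : ℝ) ^ 2 * C * |β| := by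
  rw [Finset.sum_const, nsmul_eq_mul]
  have hcard : ((linkPlaqNbr x).card : ℝ) ≤ ((6 * (d - 1 : ℕ) : ℕ) : ℝ) := by
    exact_mod_cast card_linkPlaqNbr_le x
  calc ((linkPlaqNbr x).card : ℝ) * ((((2 * (d - 1 : ℕ) : ℕ)) : ℝ) * C * |β|)
      ≤ ((6 * (d - 1 : ℕ) : ℕ) : ℝ) * ((((2 * (d - 1 : ℕ) : ℕ)) : ℝ) * C * |β|) :=
        mul_le_mul_of_nonneg_right hcard (by positivity)
    _ = 12 * ((d - 1 : ℕ) : ℝ) ^ 2 * C * |β| := by push_cast; ring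

/-- ★ **DLR uniqueness in the total-variation Dobrushin corner, every compact gauge group.** For a compact
metrisable (second countable, Hausdorff) gauge group `G`, a continuous representation `ρ` with
`|Re tr ρ(U_p)| ≤ C`, and a coupling with `12 (d−1)² C |β| < 1`, the Wilson lattice gauge theory on `ℤ^d` has at
most one DLR state. Föllmer's Dobrushin uniqueness theorem in the Vasserstein form
(`subsingleton_gibbsMeasures_of_isKRContraction`) for the discrete weight `r ≡ 1`; the measurability
bookkeeping (`val = id`, a metric for the topology of `G` by Urysohn, `TopologicalSpace.metrizableSpaceMetric`,
bounded since `G` is compact). [cite: Follmer1988, Ch. I Uniqueness theorem (2.9)] -/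
theorem subsingleton_ymGibbsMeasures_of_abs_plaquetteObs_le (hρ : Continuous ρ) {C : ℝ} (hC0 : 0 ≤ C)
    (hC : ∀ (z : Site d) (i j : Fin d) (U : LGConfig d G), |plaquetteObs ρ z i j U| ≤ C) {β : ℝ}
    (hβ : 12 * ((d - 1 : ℕ) : ℝ) ^ 2 * C * |β| < 1) :
    (ymGibbsMeasures (d := d) ρ β).Subsingleton := by
  letI m : MetricSpace G := TopologicalSpace.metrizableSpaceMetric G
  have hγ : IsSpecification (ymSpecification (d := d) ρ β) := isSpecification_ymSpecification_of_t2Space ρ hρ β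
  have hKR := isKRContraction_ymSpecification_osc (d := d) ρ hρ hC0 hC β
  obtain ⟨D, hD⟩ : ∃ D : ℝ, ∀ a b : G, dist a b ≤ D := by
    obtain ⟨D, hD⟩ := (isCompact_univ (X := G)).isBounded.subset_closedBall (1 : G)
    refine ⟨D + D, fun a b => ?_⟩
    have ha := hD (Set.mem_univ a)
    have hb := hD (Set.mem_univ b)
    rw [Metric.mem_closedBall] at ha hb
    calc dist a b ≤ dist a 1 + dist 1 b := dist_triangle _ _ _
      _ ≤ D + D := by rw [dist_comm 1 b]; exact add_le_add ha hb
  have hD0 : 0 ≤ D := dist_nonneg.trans (hD 1 1)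
  exact subsingleton_gibbsMeasures_of_isKRContraction (M := G) hγ hKR (fun _ _ => zero_le_one)
    (fun _ _ => le_rfl) id (by rw [MeasurableSpace.comap_id]) hD0 (fun a b => by simpa using hD a b)
    (by positivity) hβ (fun x => row_sum_le hC0 x)

/-- ★ **`|𝒢(β)| = 1` in the corner** (uniqueness above; existence by compactness, `ymGibbsMeasures_nonempty`).
[folklore] -/
theorem hasUniqueGibbsMeasure_of_abs_plaquetteObs_le (hρ : Continuous ρ) {C : ℝ} (hC0 : 0 ≤ C)
    (hC : ∀ (z : Site d) (i j : Fin d) (U : LGConfig d G), |plaquetteObs ρ z i j U| ≤ C) {β : ℝ}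
    (hβ : 12 * ((d - 1 : ℕ) : ℝ) ^ 2 * C * |β| < 1) :
    HasUniqueGibbsMeasure (ymSpecification (d := d) ρ β) :=
  ⟨subsingleton_ymGibbsMeasures_of_abs_plaquetteObs_le ρ hρ hC0 hC hβ, ymGibbsMeasures_nonempty ρ hρ β⟩

/-- The corner in solved form: `|β| < 1 / (12 (d−1)² C)` (`d ≥ 2`, `C > 0`) gives `|𝒢(β)| = 1`. [folklore] -/
theorem hasUniqueGibbsMeasure_of_abs_lt (hρ : Continuous ρ) {C : ℝ} (hCpos : 0 < C)
    (hC : ∀ (z : Site d) (i j : Fin d) (U : LGConfig d G), |plaquetteObs ρ z i j U| ≤ C) (hd : 2 ≤ d) {β : ℝ}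
    (hβ : |β| < 1 / (12 * ((d : ℝ) - 1) ^ 2 * C)) :
    HasUniqueGibbsMeasure (ymSpecification (d := d) ρ β) := by
  refine hasUniqueGibbsMeasure_of_abs_plaquetteObs_le ρ hρ hCpos.le hC ?_
  have hd1 : ((d - 1 : ℕ) : ℝ) = (d : ℝ) - 1 := by rw [Nat.cast_sub (by omega)]; simp
  rw [hd1]
  have hpos : 0 < 12 * ((d : ℝ) - 1) ^ 2 * C := by
    have : (1 : ℝ) ≤ (d : ℝ) - 1 := by
      have : (2 : ℝ) ≤ d := by exact_mod_cast hd
      linarith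
    positivity
  rwa [lt_div_iff₀ hpos, mul_comm] at hβ

/-- ★ **Every compact gauge group has a strong-coupling one-state corner** (hypothesis-free): for every
compact metrisable `G`, every continuous representation `ρ` and every `d` there is `β₀ > 0` with `|𝒢(β)| = 1`
for all `|β| < β₀` (`|Re tr ρ|` is bounded on the compact group, `exists_forall_abs_plaquetteObs_le`).
[cite: Georgii2011, Thm. 8.7 with Prop. 8.8 (Dobrushin uniqueness for small interactions)] -/
theorem exists_hasUniqueGibbsMeasure_abs_lt (hρ : Continuous ρ) :
    ∃ β₀ : ℝ, 0 < β₀ ∧ ∀ β : ℝ, |β| < β₀ → HasUniqueGibbsMeasure (ymSpecification (d := d) ρ β) := by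
  obtain ⟨C, hC0, hC⟩ := exists_forall_abs_plaquetteObs_le (d := d) ρ hρ
  refine ⟨1 / (12 * ((d - 1 : ℕ) : ℝ) ^ 2 * C + 1), by positivity, fun β hβ => ?_⟩
  refine hasUniqueGibbsMeasure_of_abs_plaquetteObs_le ρ hρ hC0 hC ?_
  have hK : 0 ≤ 12 * ((d - 1 : ℕ) : ℝ) ^ 2 * C := by positivity
  rw [lt_div_iff₀ (by positivity)] at hβ
  nlinarith [abs_nonneg β]

end Unique

/-! ## 3. Exponential clustering of every DLR state in the corner -/

section Decay

variable [T2Space G]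

omit [TopologicalSpace G] [IsTopologicalGroup G] [CompactSpace G] [MeasurableSpace G] [BorelSpace G]
  [SecondCountableTopology G] [T2Space G] in
/-- A sup bound is an oscillation bound for the discrete weight: `|f σ − f τ| ≤ 2 M` when `|f| ≤ M`, and `0` at
links `f` does not depend on. [folklore] -/
theorem isLipBound_one_of_abs_le [DecidableEq (ZdEdge d)] {f : LGConfig d G → ℝ} {M : ℝ}
    (hM : ∀ U, |f U| ≤ M) {Λ : Finset (ZdEdge d)} (hdep : DependsOn f (↑Λ : Set (ZdEdge d))) :
    IsLipBound (fun _ _ : G => (1 : ℝ)) f fun y => if y ∈ Λ then 2 * M else 0 := by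
  have hM0 : 0 ≤ M := (abs_nonneg _).trans (hM fun _ => 1)
  have h : IsLipBound (fun _ _ : G => (1 : ℝ)) f fun _ => 2 * M :=
    ⟨fun _ => by positivity, fun y σ τ _ => by
      rw [mul_one]
      have h1 := hM σ
      have h2 := hM τ
      rw [abs_le] at h1 h2 ⊢
      constructor <;> linarith⟩
  exact h.restrict hdep

/-- ★ **Exponential clustering for EVERY DLR state of EVERY compact gauge group in the corner.** With
`c = 12 (d−1)² C |β| ≤ 1` (`|Re tr ρ(U_p)| ≤ C`), every DLR state `μ ∈ 𝒢(β)` and all bounded measurable local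
observables `f`, `g` (depending on the finite link sets `Λ_f`, `Λ_g`, `|f| ≤ M_f`, `|g| ≤ M_g`) satisfy
`|cov_μ(f, g)| ≤ 8 M_f M_g · #Λ_f · #Λ_g · c^{⌊dist_∞(Λ_f, Λ_g)⌋}` — exponential decay in the `ℓ^∞` link-set
distance at rate `log(1/c)`. Föllmer's covariance estimate (`abs_covariance_le_of_isKRContraction`) with the
profile `ℓ = ⌊dist(·, Λ_g)⌋` (`linkSetDist_le_add_one`, `setDistEdges_le_linkSetDist`).
[cite: Follmer1988, Ch. I Theorem (2.13)] -/
theorem abs_cov_le_of_abs_plaquetteObs_le (hρ : Continuous ρ) {C : ℝ} (hC0 : 0 ≤ C)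
    (hC : ∀ (z : Site d) (i j : Fin d) (U : LGConfig d G), |plaquetteObs ρ z i j U| ≤ C) {β : ℝ}
    (hβ : 12 * ((d - 1 : ℕ) : ℝ) ^ 2 * C * |β| ≤ 1) {μ : Measure (LGConfig d G)}
    (hμ : μ ∈ ymGibbsMeasures (d := d) ρ β) {f g : LGConfig d G → ℝ} (hfm : Measurable f)
    {Λf : Finset (ZdEdge d)} (hfdep : DependsOn f (↑Λf : Set (ZdEdge d))) {Mf : ℝ} (hMf : ∀ U, |f U| ≤ Mf)
    (hgm : Measurable g) {Λg : Finset (ZdEdge d)} (hgdep : DependsOn g (↑Λg : Set (ZdEdge d))) {Mg : ℝ}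
    (hMg : ∀ U, |g U| ≤ Mg) :
    |cov[f, g; μ]| ≤ 8 * Mf * Mg * Λf.card * Λg.card *
      (12 * ((d - 1 : ℕ) : ℝ) ^ 2 * C * |β|) ^ ⌊setDistEdges Λf Λg⌋₊ := by
  classical
  set c : ℝ := 12 * ((d - 1 : ℕ) : ℝ) ^ 2 * C * |β| with hc
  have hc0 : 0 ≤ c := by positivity
  have hγ : IsSpecification (ymSpecification (d := d) ρ β) := isSpecification_ymSpecification_of_t2Space ρ hρ β
  have hKR := isKRContraction_ymSpecification_osc (d := d) ρ hρ hC0 hC β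
  have hμ' : IsGibbsMeasure (ymSpecification (d := d) ρ β) μ := hμ
  have hMf0 : 0 ≤ Mf := (abs_nonneg _).trans (hMf fun _ => 1)
  have hMg0 : 0 ≤ Mg := (abs_nonneg _).trans (hMg fun _ => 1)
  -- the profile
  set ℓ : ZdEdge d → ℕ := fun y => ⌊linkSetDist Λg y⌋₊ with hℓ
  have hℓ0 : ∀ y ∈ Λg, ℓ y = 0 := fun y hy => by simp [hℓ, linkSetDist_eq_zero_of_mem hy]
  have hℓ1 : ∀ x ∉ Λg, ∀ y ∈ linkPlaqNbr x, ℓ x ≤ ℓ y + 1 := fun x _ y hy => by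
    calc ℓ x ≤ ⌊linkSetDist Λg y + 1⌋₊ := Nat.floor_mono (linkSetDist_le_add_one hy)
      _ = ℓ y + 1 := Nat.floor_add_one (linkSetDist_nonneg _ _)
  have key := abs_covariance_le_of_isKRContraction hγ hKR (fun _ _ => zero_le_one) (fun _ _ => le_rfl)
    zero_le_one hc0 hβ (fun x => row_sum_le hC0 x) hμ' hfm hfdep hMf (isLipBound_one_of_abs_le hMf hfdep)
    hgm hgdep hMg (isLipBound_one_of_abs_le hMg hgdep) ℓ hℓ0 hℓ1
  have hsum₂ : ∑ y ∈ Λg, (if y ∈ Λg then 2 * Mg else 0) = Λg.card * (2 * Mg) := by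
    rw [Finset.sum_ite_of_true (fun y hy => hy), Finset.sum_const, nsmul_eq_mul]
  have hm : ∀ y ∈ Λf, ⌊setDistEdges Λf Λg⌋₊ ≤ ℓ y := fun y hy =>
    Nat.floor_mono (setDistEdges_le_linkSetDist hy)
  have hc1 : c ≤ 1 := hβ
  have hsum₁ : ∑ y ∈ Λf, c ^ ℓ y * (if y ∈ Λf then 2 * Mf else 0) ≤
      Λf.card * (c ^ ⌊setDistEdges Λf Λg⌋₊ * (2 * Mf)) := by
    calc ∑ y ∈ Λf, c ^ ℓ y * (if y ∈ Λf then 2 * Mf else 0)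
        ≤ ∑ _y ∈ Λf, c ^ ⌊setDistEdges Λf Λg⌋₊ * (2 * Mf) := Finset.sum_le_sum fun y hy => by
          rw [if_pos hy]
          exact mul_le_mul_of_nonneg_right (pow_le_pow_of_le_one hc0 hc1 (hm y hy)) (by positivity)
      _ = Λf.card * (c ^ ⌊setDistEdges Λf Λg⌋₊ * (2 * Mf)) := by rw [Finset.sum_const, nsmul_eq_mul]
  calc |cov[f, g; μ]|
      ≤ 2 * (1 : ℝ) ^ 2 * (∑ y ∈ Λg, (if y ∈ Λg then 2 * Mg else 0)) *
          ∑ y ∈ Λf, c ^ ℓ y * (if y ∈ Λf then 2 * Mf else 0) := key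
    _ ≤ 2 * (1 : ℝ) ^ 2 * (Λg.card * (2 * Mg)) * (Λf.card * (c ^ ⌊setDistEdges Λf Λg⌋₊ * (2 * Mf))) := by
        rw [hsum₂]
        exact mul_le_mul_of_nonneg_left hsum₁ (by positivity)
    _ = 8 * Mf * Mg * Λf.card * Λg.card * c ^ ⌊setDistEdges Λf Λg⌋₊ := by ring

/-- **Exponential form of the clustering bound**: `c^{⌊D⌋} ≤ c⁻¹ · e^{−(log c⁻¹) D}` for `0 < c ≤ 1`, so the
bound above is `≤ 8 M_f M_g #Λ_f #Λ_g c⁻¹ exp(−log(1/c) · dist(Λ_f, Λ_g))`: decay rate `m = log(1/c) > 0` when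
`c < 1`. [folklore] -/
theorem pow_floor_le_exp {c D : ℝ} (hc0 : 0 < c) (hc1 : c ≤ 1) :
    c ^ ⌊D⌋₊ ≤ c⁻¹ * Real.exp (-(Real.log c⁻¹) * D) := by
  have hfl : D - 1 ≤ (⌊D⌋₊ : ℝ) := by
    have := Nat.lt_floor_add_one D
    linarith
  rw [Real.log_inv, neg_neg, ← Real.rpow_natCast, Real.rpow_def_of_pos hc0,
    ← Real.exp_log hc0, ← Real.exp_neg, Real.log_exp, ← Real.exp_add]
  refine Real.exp_le_exp.2 ?_
  have hlog : Real.log c ≤ 0 := Real.log_nonpos hc0.le hc1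
  nlinarith

end Decay

/-! ## 4. Rows: unitary representations, `U(1)`, `SU(N)` -/

section Rows

variable [T2Space G]

/-- **Unitary representations**: `|Re tr ρ(U_p)| ≤ N` (`abs_plaquetteObs_le_holds`), so `|𝒢(β)| = 1` whenever
`12 (d−1)² N |β| < 1`. [folklore] -/
theorem hasUniqueGibbsMeasure_of_unitary (hρ : Continuous ρ) (hρu : ∀ g, ρ g ∈ Matrix.unitaryGroup (Fin N) ℂ)
    {β : ℝ} (hβ : 12 * ((d - 1 : ℕ) : ℝ) ^ 2 * N * |β| < 1) :
    HasUniqueGibbsMeasure (ymSpecification (d := d) ρ β) :=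
  hasUniqueGibbsMeasure_of_abs_plaquetteObs_le ρ hρ (Nat.cast_nonneg N) (abs_plaquetteObs_le_holds ρ hρu) hβ

/-- **Unitary representations, clustering**: with `c = 12 (d−1)² N |β| ≤ 1`, every DLR state satisfies
`|cov(f, g)| ≤ 8 M_f M_g #Λ_f #Λ_g c^{⌊dist(Λ_f, Λ_g)⌋}`. [folklore] -/
theorem abs_cov_le_of_unitary (hρ : Continuous ρ) (hρu : ∀ g, ρ g ∈ Matrix.unitaryGroup (Fin N) ℂ)
    {β : ℝ} (hβ : 12 * ((d - 1 : ℕ) : ℝ) ^ 2 * N * |β| ≤ 1) {μ : Measure (LGConfig d G)}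
    (hμ : μ ∈ ymGibbsMeasures (d := d) ρ β) {f g : LGConfig d G → ℝ} (hfm : Measurable f)
    {Λf : Finset (ZdEdge d)} (hfdep : DependsOn f (↑Λf : Set (ZdEdge d))) {Mf : ℝ} (hMf : ∀ U, |f U| ≤ Mf)
    (hgm : Measurable g) {Λg : Finset (ZdEdge d)} (hgdep : DependsOn g (↑Λg : Set (ZdEdge d))) {Mg : ℝ}
    (hMg : ∀ U, |g U| ≤ Mg) :
    |cov[f, g; μ]| ≤ 8 * Mf * Mg * Λf.card * Λg.card *
      (12 * ((d - 1 : ℕ) : ℝ) ^ 2 * N * |β|) ^ ⌊setDistEdges Λf Λg⌋₊ :=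
  abs_cov_le_of_abs_plaquetteObs_le ρ hρ (Nat.cast_nonneg N) (abs_plaquetteObs_le_holds ρ hρu) hβ hμ hfm hfdep
    hMf hgm hgdep hMg

end Rows

section U1

variable [MeasurableSpace Circle] [BorelSpace Circle]

/-- ★ **Compact `U(1)` lattice gauge theory has a unique DLR state at `|β| < 1/(12 (d−1)²)`** (every `d`; for
`d = 4`: `|β| < 1/108`; `d = 3`: `|β| < 1/48`) — the defining representation `u1Rep` is unitary of degree `1`.
The tree had no uniqueness statement for `U(1)`. [folklore] -/
theorem u1_hasUniqueGibbsMeasure {β : ℝ} (hβ : 12 * ((d - 1 : ℕ) : ℝ) ^ 2 * |β| < 1) :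
    HasUniqueGibbsMeasure (ymSpecification (d := d) u1Rep β) := by
  have h := hasUniqueGibbsMeasure_of_unitary (d := d) u1Rep continuous_u1Rep u1Rep_mem_unitaryGroup (β := β)
  simp only [Nat.cast_one, mul_one] at h
  exact h hβ

/-- `U(1)`, `d = 4`: a unique DLR state for `|β| < 1/108`. [folklore] -/
theorem u1_four_hasUniqueGibbsMeasure {β : ℝ} (hβ : |β| < 1 / 108) :
    HasUniqueGibbsMeasure (ymSpecification (d := 4) u1Rep β) :=
  u1_hasUniqueGibbsMeasure (d := 4) (by norm_num; linarith)

/-- `U(1)`, `d = 3`: a unique DLR state for `|β| < 1/48`. [folklore] -/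
theorem u1_three_hasUniqueGibbsMeasure {β : ℝ} (hβ : |β| < 1 / 48) :
    HasUniqueGibbsMeasure (ymSpecification (d := 3) u1Rep β) :=
  u1_hasUniqueGibbsMeasure (d := 3) (by norm_num; linarith)

/-- ★ **`U(1)` clustering**: at `c = 12 (d−1)² |β| ≤ 1` every DLR state of compact `U(1)` lattice gauge theory
satisfies `|cov(f, g)| ≤ 8 M_f M_g #Λ_f #Λ_g c^{⌊dist(Λ_f, Λ_g)⌋}`. [folklore] -/
theorem u1_abs_cov_le {β : ℝ} (hβ : 12 * ((d - 1 : ℕ) : ℝ) ^ 2 * |β| ≤ 1) {μ : Measure (LGConfig d Circle)}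
    (hμ : μ ∈ ymGibbsMeasures (d := d) u1Rep β) {f g : LGConfig d Circle → ℝ} (hfm : Measurable f)
    {Λf : Finset (ZdEdge d)} (hfdep : DependsOn f (↑Λf : Set (ZdEdge d))) {Mf : ℝ} (hMf : ∀ U, |f U| ≤ Mf)
    (hgm : Measurable g) {Λg : Finset (ZdEdge d)} (hgdep : DependsOn g (↑Λg : Set (ZdEdge d))) {Mg : ℝ}
    (hMg : ∀ U, |g U| ≤ Mg) :
    |cov[f, g; μ]| ≤ 8 * Mf * Mg * Λf.card * Λg.card *
      (12 * ((d - 1 : ℕ) : ℝ) ^ 2 * |β|) ^ ⌊setDistEdges Λf Λg⌋₊ := by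
  have h := abs_cov_le_of_unitary (d := d) u1Rep continuous_u1Rep u1Rep_mem_unitaryGroup (β := β)
    (μ := μ) (f := f) (g := g)
  simp only [Nat.cast_one, mul_one] at h
  exact h hβ hμ hfm hfdep hMf hgm hgdep hMg

end U1

section SUN

/-- `SU(N) ⊆ M_N(ℂ)` is second countable. [folklore] -/
private theorem suN_secondCountableTopology (N : ℕ) : SecondCountableTopology (Matrix.specialUnitaryGroup (Fin N) ℂ) :=
  haveI : SecondCountableTopology (Matrix (Fin N) (Fin N) ℂ) :=
    inferInstanceAs (SecondCountableTopology (Fin N → Fin N → ℂ))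
  Topology.IsEmbedding.subtypeVal.secondCountableTopology

/-- **`SU(N)` in the fundamental representation**: `|𝒢(β)| = 1` at `12 (d−1)² N |β| < 1` (tree coupling). WEAKER
than the tree's `SU(N)` windows (`StarSUN.hasUniqueGibbsMeasure_abs`: 't Hooft `|β|/N ≤ 9/308` at `d = 4`); recorded
as the value of the every-group formula. [folklore] -/
theorem suN_hasUniqueGibbsMeasure {N : ℕ} {β : ℝ} (hβ : 12 * ((d - 1 : ℕ) : ℝ) ^ 2 * N * |β| < 1) :
    HasUniqueGibbsMeasure (ymSpecification (d := d) (fundamentalRep (Fin N)) β) :=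
  haveI := suN_secondCountableTopology N
  hasUniqueGibbsMeasure_of_unitary (d := d) (fundamentalRep (Fin N)) (continuous_fundamentalRep (Fin N))
    fundamentalRep_mem_unitaryGroup hβ

/-- `SU(2)`, `d = 4`: the every-group formula gives `|𝒢(β)| = 1` for `|β| < 1/216` (tree units; `β_W < 1/108`).
[folklore] -/
theorem su2_four_hasUniqueGibbsMeasure {β : ℝ} (hβ : |β| < 1 / 216) :
    HasUniqueGibbsMeasure (ymSpecification (d := 4) (fundamentalRep (Fin 2)) β) :=
  suN_hasUniqueGibbsMeasure (d := 4) (N := 2) (by norm_num; linarith)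

end SUN

end Summit.Ventures.YMGap.StrongCouplingAllGroups

end
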